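import Mathlib.MeasureTheory.Integral.IntervalIntegral.FundThmCalculus
import Mathlib.MeasureTheory.Integral.DominatedConvergence
import Mathlib.Analysis.Calculus.FDeriv.Measurable
import Mathlib.Analysis.SpecialFunctions.Log.Deriv
import HarnessLib

/-!
# The tilted cumulant generating function from right derivatives

Analysis/Calculus support file (everything proved). The elementary real-variable step behind
Green–Kubo-type formulae for large-deviation generating functions of stationary processes
(Dembo–Zeitouni 2010 §2.3, tilted laws; Jakšić–Pillet–Rey-Bellet 2011 for deterministic dynamics):
if `Z(u) = E e^{βJ_u}`, `Nu(u) = E[F e^{βJ_u}]`, `M(u) = E[F_u F e^{βJ_u}]` are the tilted moments of an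
additive functional `J_u = ∫₀ᵘ F_r dr`, one typically only knows that `Z` and `Nu` are continuous with
RIGHT derivatives `Z'₊ = β Nu`, `Nu'₊ = β M` (the integrand `r ↦ F_r` being merely right-continuous),
`M` bounded. This suffices:

* `log_eq_of_hasDeriv_right` — then, for `β ≠ 0` and `h ≥ 0`,
  `log Z(h) = β h Nu(0) + β² ∫₀ʰ ∫₀ˢ (M/Z − (Nu/Z)²)(u) du ds`
  (FTC-2 from right derivatives, `intervalIntegral.integral_eq_sub_of_hasDeriv_right_of_le`, for `log Z`
  and for `Nu/Z`; the right derivative of the continuous function `Nu/Z` is automatically measurable,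
  `measurable_derivWithin_Ioi`, and it is dominated by the continuous function `K/Z + (Nu/Z)²`).

## References

* A. Dembo, O. Zeitouni, *Large Deviations Techniques and Applications* (2010), §2.3.
* V. Jakšić, C.-A. Pillet, L. Rey-Bellet, *Entropic fluctuations in statistical mechanics: I.
  Classical dynamical systems*, Nonlinearity 24 (2011), arXiv:1009.3248.
-/

noncomputable section

open MeasureTheory Set Filter Topology

namespace Literature.Analysis.Calculus

/-- **Tilted-CGF calculus.** If `Z, Nu : ℝ → ℝ` are continuous, `Z > 0`, `Z 0 = 1`, `Z` has right
derivative `β Nu` and `Nu` has right derivative `β M` everywhere, `M` is bounded on `[0, h]`, `β ≠ 0` and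
`0 ≤ h`, then `log Z(h) = β h Nu(0) + β² ∫₀ʰ ∫₀ˢ (M/Z − (Nu/Z)(Nu/Z))(u) du ds`. [folklore] -/
theorem log_eq_of_hasDeriv_right {Z Nu M : ℝ → ℝ} {β h : ℝ} (hβ : β ≠ 0) (hh : 0 ≤ h)
    (hZc : Continuous Z) (hNuc : Continuous Nu) (hpos : ∀ u, 0 < Z u) (hZ0 : Z 0 = 1)
    (hZd : ∀ u, HasDerivWithinAt Z (β * Nu u) (Ioi u) u)
    (hNud : ∀ u, HasDerivWithinAt Nu (β * M u) (Ioi u) u)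
    (hM : ∃ K, ∀ u ∈ Icc 0 h, |M u| ≤ K) :
    Real.log (Z h) = β * h * Nu 0 +
      β ^ 2 * ∫ s in (0 : ℝ)..h, ∫ u in (0 : ℝ)..s, (M u / Z u - Nu u / Z u * (Nu u / Z u)) := by
  obtain ⟨K, hK⟩ := hM
  have hZne : ∀ u, Z u ≠ 0 := fun u => (hpos u).ne'
  obtain ⟨q, hq⟩ : ∃ q : ℝ → ℝ, ∀ u, q u = Nu u / Z u := ⟨fun u => Nu u / Z u, fun _ => rfl⟩
  obtain ⟨e, he⟩ : ∃ e : ℝ → ℝ, ∀ u, e u = M u / Z u - Nu u / Z u * (Nu u / Z u) :=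
    ⟨fun u => M u / Z u - Nu u / Z u * (Nu u / Z u), fun _ => rfl⟩
  have hqfun : q = fun u => Nu u / Z u := funext hq
  have hqc : Continuous q := hqfun ▸ hNuc.div hZc hZne
  have hqd : ∀ u, HasDerivWithinAt q (β * e u) (Ioi u) u := fun u => by
    rw [hqfun]
    refine ((hNud u).fun_div (hZd u) (hZne u)).congr_deriv ?_
    have := hZne u
    rw [he]
    field_simp
  -- the right derivative of the continuous function `q` is measurable, hence so is `e = β⁻¹ • (β e)`
  have hem : Measurable e := by
    have h1 : (fun u => derivWithin q (Ioi u) u) = fun u => β * e u :=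
      funext fun u => (hqd u).derivWithin (uniqueDiffWithinAt_Ioi u)
    have h2 : Measurable fun u => β * e u := h1 ▸ measurable_derivWithin_Ioi q
    simpa only [inv_mul_cancel_left₀ hβ] using h2.const_mul β⁻¹
  -- `e` is interval integrable on `[0, s]`, `s ∈ [0, h]` (dominated by a continuous function)
  have hei : ∀ s ∈ Icc 0 h, IntervalIntegrable e volume 0 s := by
    intro s hs
    have hg : Continuous fun u => K / Z u + q u * q u :=
      (continuous_const.div hZc hZne).add (hqc.mul hqc)
    refine (hg.intervalIntegrable 0 s).mono_fun' hem.aestronglyMeasurable ?_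
    rw [uIoc_of_le hs.1]
    refine (ae_restrict_mem measurableSet_Ioc).mono fun u hu => ?_
    have hu' : u ∈ Icc 0 h := ⟨hu.1.le, hu.2.trans hs.2⟩
    show ‖e u‖ ≤ K / Z u + q u * q u
    rw [Real.norm_eq_abs, he]
    calc |M u / Z u - Nu u / Z u * (Nu u / Z u)|
        ≤ |M u / Z u| + |Nu u / Z u * (Nu u / Z u)| := abs_sub _ _
      _ = |M u| / Z u + q u * q u := by rw [abs_div, abs_of_pos (hpos u), hq, abs_mul_self]
      _ ≤ K / Z u + q u * q u :=
          add_le_add (div_le_div_of_nonneg_right (hK u hu') (hpos u).le) le_rfl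
  -- FTC-2 for `log Z`
  have hlog : Real.log (Z h) = ∫ u in (0 : ℝ)..h, β * q u := by
    have hc : ContinuousOn (fun u => Real.log (Z u)) (Icc 0 h) :=
      hZc.continuousOn.log fun u _ => hZne u
    have hd : ∀ u ∈ Ioo 0 h, HasDerivWithinAt (fun u => Real.log (Z u)) (β * q u) (Ioi u) u :=
      fun u _ => ((hZd u).log (hZne u)).congr_deriv (by rw [hq, mul_div_assoc])
    have := intervalIntegral.integral_eq_sub_of_hasDeriv_right_of_le hh hc hd
      ((continuous_const.mul hqc).intervalIntegrable 0 h)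
    rw [this, hZ0, Real.log_one, sub_zero]
  -- FTC-2 for `q = Nu / Z`
  have hqftc : ∀ s ∈ Icc 0 h, q s = Nu 0 + β * ∫ u in (0 : ℝ)..s, e u := by
    intro s hs
    have := intervalIntegral.integral_eq_sub_of_hasDeriv_right_of_le hs.1 hqc.continuousOn
      (fun u _ => hqd u) ((hei s hs).const_mul β)
    rw [intervalIntegral.integral_const_mul] at this
    have hq0 : q 0 = Nu 0 := by rw [hq, hZ0, div_one]
    linarith
  have hprim : IntervalIntegrable (fun s => ∫ u in (0 : ℝ)..s, e u) volume 0 h :=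
    (intervalIntegral.continuousOn_primitive_interval' (hei h ⟨hh, le_rfl⟩)
      left_mem_uIcc).intervalIntegrable
  have key : Real.log (Z h) = β * h * Nu 0 + β ^ 2 * ∫ s in (0 : ℝ)..h, ∫ u in (0 : ℝ)..s, e u := by
    calc Real.log (Z h) = ∫ s in (0 : ℝ)..h, β * q s := hlog
      _ = ∫ s in (0 : ℝ)..h, (β * Nu 0 + β ^ 2 * ∫ u in (0 : ℝ)..s, e u) := by
          refine intervalIntegral.integral_congr fun s hs => ?_
          rw [uIcc_of_le hh] at hs
          simp only [hqftc s hs]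
          ring
      _ = β * h * Nu 0 + β ^ 2 * ∫ s in (0 : ℝ)..h, ∫ u in (0 : ℝ)..s, e u := by
          rw [intervalIntegral.integral_add intervalIntegrable_const (hprim.const_mul _),
            intervalIntegral.integral_const, intervalIntegral.integral_const_mul]
          simp only [sub_zero, smul_eq_mul]
          ring
  simpa only [he] using key

end Literature.Analysis.Calculus

end
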